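import Mathlib
import HarnessLib.Audit
import Summits.PneNP.PneNP.Theorems.ClusOshSplit

/-!
# Route ClusUniversalCertificate — F1(e): colex-standard sets are the iterated down-compression (Mészáros–Rónyai), closing `ColexStdIffDown`
(rung F-N1, cell pnp-ideate, crux `UniversalCertAll` = stmt-PneNP-19683; planner p1 g14, `lines/osh-P2.md` §2 F1(e) (Mészáros–Rónyai, *Standard monomials and
extremal point sets*, Discrete Math. 2019, Thm 2, specialised to `𝔽₂` points and colex); restricted-model combinatorics — nothing here bears on `P` versus `NP`)

Both sides satisfy the SAME recursion along the largest coordinate: the standard sets by `ClusOshSplit.colexStd_emb` / `colexStd_insert`, the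
compressed family because compressing the last coordinate of the supports of `Y` yields `supp(U) ⊔ (supp(I) + last)` (`compression_last_supp`) and the
remaining compressions act on the two halves separately (`compression_castSucc_splitFam`).  Induction on the dimension:

* `splitFam`, `mem_splitFam`; `pt`/`supp` bookkeeping (`mem_image_supp`, `pt_eq_snoc`);
* `oshDown_succ` — `oshDown Y = splitFam (oshDown U) (oshDown I)`;
* `colexStd_iff_mem_oshDown` and `colexStdIffDown : ColexStdIffDown` (the node of `ClusOshRungs`, by name); hence `oshS_eq_weight` and
  `oshRungDown_iff_oshRung` unconditionally.
-/

set_option linter.dupNamespace false -- `Summit.PneNP.PneNP.…`: summit = sub-problem name (D-0017 single-conjunct layout)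

namespace Summit.PneNP.PneNP.Theorems.ClusHilbert.Osh

open Finset
open scoped FinsetFamily
open Summit.PneNP.PneNP.Theorems.ClusCube (V pt)
open Summit.PneNP.PneNP.Theorems.ClusHilbert (chi resTo)

variable {N : ℕ}

/-! ## Supports and points -/

/-- `supp (pt T) = T`. -/
theorem supp_pt (T : Finset (Fin N)) : supp (pt T) = T := by
  ext i
  unfold supp ClusCube.pt
  simp only [mem_filter, mem_univ, true_and, ne_eq, ite_eq_right_iff, one_ne_zero, imp_false, not_not]

/-- `pt (supp x) = x`. -/
theorem pt_supp (x : V N) : pt (supp x) = x := by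
  funext i
  unfold supp ClusCube.pt
  simp only [mem_filter, mem_univ, true_and]
  rcases (by decide : ∀ z : ZMod 2, z = 0 ∨ z = 1) (x i) with h | h <;> simp [h]

/-- Membership in the support family. -/
theorem mem_image_supp {Y : Finset (V N)} {T : Finset (Fin N)} : T ∈ Y.image supp ↔ pt T ∈ Y := by
  rw [mem_image]
  constructor
  · rintro ⟨y, hy, rfl⟩; rw [pt_supp]; exact hy
  · intro h; exact ⟨pt T, h, supp_pt T⟩

/-- The point of a set, split along the last coordinate. -/
theorem pt_eq_snoc (T : Finset (Fin (N + 1))) :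
    pt T = Fin.snoc (pt (cut (T.erase (Fin.last N)))) (if Fin.last N ∈ T then (1 : ZMod 2) else 0) := by
  funext a
  induction a using Fin.lastCases with
  | last => unfold ClusCube.pt; rw [Fin.snoc_last]
  | cast i =>
    rw [Fin.snoc_castSucc]
    unfold ClusCube.pt cut
    simp only [mem_filter, mem_univ, true_and, mem_erase, ne_eq]
    by_cases h : Fin.castSucc i ∈ T
    · rw [if_pos h, if_pos ⟨(Fin.castSucc_lt_last i).ne, h⟩]
    · rw [if_neg h, if_neg (fun h' => h h'.2)]

/-- `cut` ignores the last coordinate. -/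
theorem cut_erase_last (T : Finset (Fin (N + 1))) : cut (T.erase (Fin.last N)) = cut T := by
  ext i
  unfold cut
  simp only [mem_filter, mem_univ, true_and, mem_erase, ne_eq]
  exact ⟨fun h => h.2, fun h => ⟨(Fin.castSucc_lt_last i).ne, h⟩⟩

/-! ## The split family -/

/-- `𝒜₀ ⊔ (𝒜₁ + last)`, both halves embedded from the first `N` coordinates. -/
def splitFam (𝒜₀ 𝒜₁ : Finset (Finset (Fin N))) : Finset (Finset (Fin (N + 1))) :=
  𝒜₀.image emb ∪ 𝒜₁.image fun S => insert (Fin.last N) (emb S)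

/-- Membership in the split family. -/
theorem mem_splitFam {𝒜₀ 𝒜₁ : Finset (Finset (Fin N))} {T : Finset (Fin (N + 1))} :
    T ∈ splitFam 𝒜₀ 𝒜₁ ↔ (Fin.last N ∉ T ∧ cut T ∈ 𝒜₀) ∨ (Fin.last N ∈ T ∧ cut T ∈ 𝒜₁) := by
  unfold splitFam
  rw [mem_union, mem_image, mem_image]
  constructor
  · rintro (⟨S, hS, rfl⟩ | ⟨S, hS, rfl⟩)
    · exact Or.inl ⟨last_notMem_emb S, by rw [cut_emb]; exact hS⟩
    · refine Or.inr ⟨mem_insert_self _ _, ?_⟩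
      rw [← cut_erase_last, erase_insert (last_notMem_emb S), cut_emb]; exact hS
  · rintro (⟨hl, h⟩ | ⟨hl, h⟩)
    · exact Or.inl ⟨cut T, h, emb_cut hl⟩
    · refine Or.inr ⟨cut T, h, ?_⟩
      rw [← cut_erase_last, emb_cut (fun h' => (mem_erase.1 h').1 rfl), insert_erase hl]

/-! ## The first compression: the last coordinate -/

/-- **Compressing the last coordinate of the supports of `Y` gives `supp(U) ⊔ (supp(I) + last)`.** -/
theorem compression_last_supp (Y : Finset (V (N + 1))) :
    𝓓 (Fin.last N) (Y.image supp) = splitFam ((proj Y).image supp) ((dbl Y).image supp) := by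
  ext T
  rw [Down.mem_compression, mem_splitFam, mem_image_supp, mem_image_supp, mem_image_supp, mem_image_supp, mem_image_supp]
  have h0 : pt (T.erase (Fin.last N)) = Fin.snoc (pt (cut T)) (0 : ZMod 2) := by
    rw [pt_eq_snoc, erase_idem, cut_erase_last, if_neg (fun h => (mem_erase.1 h).1 rfl)]
  have h1 : pt (insert (Fin.last N) T) = Fin.snoc (pt (cut T)) (1 : ZMod 2) := by
    rw [pt_eq_snoc, if_pos (mem_insert_self _ _), cut_erase_last]
    congr 2
    ext i; unfold cut; simp only [mem_filter, mem_univ, true_and, mem_insert, (Fin.castSucc_lt_last i).ne, false_or]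
  by_cases hl : Fin.last N ∈ T
  · have hT : pt T = Fin.snoc (pt (cut T)) (1 : ZMod 2) := by rw [pt_eq_snoc, if_pos hl, cut_erase_last]
    rw [insert_eq_of_mem hl, hT, h0]
    unfold proj dbl
    rw [mem_union, mem_inter, mem_lvl, mem_lvl]
    tauto
  · have hT : pt T = Fin.snoc (pt (cut T)) (0 : ZMod 2) := by rw [pt_eq_snoc, if_neg hl, cut_erase_last]
    rw [erase_eq_of_notMem hl, hT, h1]
    unfold proj dbl
    rw [mem_union, mem_inter, mem_lvl, mem_lvl]
    tauto

/-! ## The other compressions commute with the split -/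

/-- `cut` and `erase` of an embedded coordinate. -/
theorem cut_erase_castSucc (T : Finset (Fin (N + 1))) (i : Fin N) : cut (T.erase (Fin.castSucc i)) = (cut T).erase i := by
  ext j
  unfold cut
  simp only [mem_filter, mem_univ, true_and, mem_erase, ne_eq, (Fin.castSucc_injective N).eq_iff]

/-- `cut` and `insert` of an embedded coordinate. -/
theorem cut_insert_castSucc (T : Finset (Fin (N + 1))) (i : Fin N) : cut (insert (Fin.castSucc i) T) = insert i (cut T) := by
  ext j
  unfold cut
  simp only [mem_filter, mem_univ, true_and, mem_insert, (Fin.castSucc_injective N).eq_iff]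

/-- **Compressing an earlier coordinate acts on the two halves separately.** -/
theorem compression_castSucc_splitFam (i : Fin N) (𝒜₀ 𝒜₁ : Finset (Finset (Fin N))) :
    𝓓 (Fin.castSucc i) (splitFam 𝒜₀ 𝒜₁) = splitFam (𝓓 i 𝒜₀) (𝓓 i 𝒜₁) := by
  ext T
  have hne : Fin.castSucc i ≠ Fin.last N := (Fin.castSucc_lt_last i).ne
  have hle : (Fin.last N ∈ T.erase (Fin.castSucc i)) ↔ Fin.last N ∈ T := by
    rw [mem_erase]; exact ⟨fun h => h.2, fun h => ⟨hne.symm, h⟩⟩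
  have hli : (Fin.last N ∈ insert (Fin.castSucc i) T) ↔ Fin.last N ∈ T := by
    rw [mem_insert]; exact ⟨fun h => h.resolve_left hne.symm, fun h => Or.inr h⟩
  rw [Down.mem_compression, mem_splitFam, mem_splitFam, mem_splitFam, mem_splitFam, Down.mem_compression, Down.mem_compression, hle, hli,
    cut_erase_castSucc, cut_insert_castSucc]
  by_cases hl : Fin.last N ∈ T
  · tauto
  · tauto

/-- Iterating: all earlier compressions act on the halves separately. -/
theorem downAll_map_castSucc_splitFam (l : List (Fin N)) (𝒜₀ 𝒜₁ : Finset (Finset (Fin N))) :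
    downAll (l.map Fin.castSucc) (splitFam 𝒜₀ 𝒜₁) = splitFam (downAll l 𝒜₀) (downAll l 𝒜₁) := by
  induction l generalizing 𝒜₀ 𝒜₁ with
  | nil => rfl
  | cons a l ih =>
    show downAll (l.map Fin.castSucc) (𝓓 (Fin.castSucc a) (splitFam 𝒜₀ 𝒜₁)) = splitFam (downAll l (𝓓 a 𝒜₀)) (downAll l (𝓓 a 𝒜₁))
    rw [compression_castSucc_splitFam, ih]

/-- **The compressed family obeys the recursion: `oshDown Y = oshDown U ⊔ (oshDown I + last)`.** -/
theorem oshDown_succ (Y : Finset (V (N + 1))) : oshDown Y = splitFam (oshDown (proj Y)) (oshDown (dbl Y)) := by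
  unfold oshDown
  have hl : (List.finRange (N + 1)).reverse = Fin.last N :: ((List.finRange N).reverse.map Fin.castSucc) := by
    rw [List.finRange_succ_last]
    simp [List.reverse_append, List.map_reverse]
  rw [hl]
  show downAll ((List.finRange N).reverse.map Fin.castSucc) (𝓓 (Fin.last N) (Y.image supp)) = _
  rw [compression_last_supp, downAll_map_castSucc_splitFam]

/-! ## F1(e) -/

/-- In dimension `0`: `∅` is standard iff `Y ≠ ∅`. -/
theorem colexStd_empty_iff (Y : Finset (V N)) : colexStd Y ∅ ↔ Y.Nonempty := by
  unfold colexStd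
  have hempty : {T' : Finset (Fin N) | toColex T' < toColex (∅ : Finset (Fin N))} = ∅ := by
    ext T'
    simp only [Set.mem_setOf_eq, Set.mem_empty_iff_false, iff_false, not_lt]
    rw [Colex.toColex_le_toColex]
    intro a ha _; exact absurd ha (notMem_empty a)
  rw [hempty, Set.image_empty, Submodule.span_empty, Submodule.mem_bot]
  constructor
  · intro h
    by_contra hY
    rw [not_nonempty_iff_eq_empty] at hY
    subst hY
    exact h (funext fun y => absurd y.2 (notMem_empty _))
  · rintro ⟨y, hy⟩ h
    have := congrFun h ⟨y, hy⟩
    simp [ClusHilbert.resTo, ClusHilbert.chi] at this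

/-- **F1(e): the colex-standard sets of `Y` are exactly the iterated down-compression of its supports.** -/
theorem colexStd_iff_mem_oshDown : ∀ (N : ℕ) (Y : Finset (V N)) (T : Finset (Fin N)), colexStd Y T ↔ T ∈ oshDown Y := by
  intro N
  induction N with
  | zero =>
    intro Y T
    have hT : T = ∅ := eq_empty_of_forall_notMem fun i _ => i.elim0
    subst hT
    rw [colexStd_empty_iff]
    unfold oshDown
    show Y.Nonempty ↔ ∅ ∈ downAll (List.finRange 0).reverse (Y.image supp)
    rw [List.finRange_zero, List.reverse_nil]
    show Y.Nonempty ↔ ∅ ∈ Y.image supp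
    rw [mem_image_supp]
    constructor
    · rintro ⟨y, hy⟩
      have : pt (∅ : Finset (Fin 0)) = y := funext fun i => i.elim0
      rw [this]; exact hy
    · intro h; exact ⟨_, h⟩
  | succ N ih =>
    intro Y T
    rw [oshDown_succ, mem_splitFam]
    by_cases hl : Fin.last N ∈ T
    · have hT : T = insert (Fin.last N) (emb (cut (T.erase (Fin.last N)))) := by
        rw [emb_cut (fun h => (mem_erase.1 h).1 rfl), insert_erase hl]
      rw [hT, colexStd_insert, ih, ← hT, cut_erase_last]
      simp only [hl, not_true, false_and, true_and, false_or]
    · have hT : T = emb (cut T) := (emb_cut hl).symm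
      rw [hT, colexStd_emb, ih, ← hT]
      simp only [hl, not_false_eq_true, true_and, false_and, or_false]

/-- **`ColexStdIffDown` holds** (the node of `ClusOshRungs`, by name). -/
theorem colexStdIffDown : ColexStdIffDown := colexStd_iff_mem_oshDown

/-- Hence `S(Y)` IS the total weight of the compressed family. -/
theorem oshS_eq_weight (Y : Finset (V N)) : oshS Y = ∑ s ∈ oshDown Y, s.card := oshS_eq_weight_of colexStdIffDown Y

/-- Hence the downshift form of the one-block rung IS the span form. -/
theorem oshRungDown_iff_oshRung (N : ℕ) : OshRungDown N ↔ OshRung N := oshRungDown_iff_oshRung_of colexStdIffDown N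

end Summit.PneNP.PneNP.Theorems.ClusHilbert.Osh
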